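import Summits.CriticalPhenomena.PercolationContinuityZ3.Theorems.PercNearOneGluingNoHeavyLowerTailThreePointLBSwitchingMaps
import HarnessLib

/-!
# `NoHeavyLowerTail` (stmt-CriticalPhenomena-4575) — GROUP three-point lower bound `GRP3PTLB`
# (Sahi/Kahn `E₃ ≥ 0` for the pairwise separations of two vertex SETS and a vertex), I: clusters of a vertex set

Support file (prover prim-ineq-prove-3, gen 5; `--supports stmt-CriticalPhenomena-4575`).  No named facts, no sorries.

This is the first of four files formalising `GRP3PTLB` (this seat's FINDING-GRP3PTLB.md, 2026-08-19): for
Bernoulli bond percolation with arbitrary edge weights on a finite graph, any vertex sets `A, B` and any vertex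
`c`, Sahi's third-order functional of the three pairwise GROUP-separation events is nonnegative,
`0 ≤ E₃(D[A|B], D[A|c], D[B|c])`, `D[X|Y] = {no open path between X and Y}`.  It generalises the tree theorem
`ThreePointLB.sahiE3_pairSep_nonneg` (`A = {a}`, `B = {b}`; prim-lit-2 PROOF-3PTLB.md, formalised by prim-cert-2)
and is NOT its corollary on a quotient graph (group connection is not transitive).  The proof is prim-lit-2's
"Variant C" four-switching certificate carried from points to groups: the explorations grow the cluster of a
SET (`clS K A = ⋃_{a ∈ A} cl K a`) in one copy and hand its edge region to another copy.

Here: the vocabulary `clS`, the group-connection event `gconn A B`, the facts F1–F4 of PROOF-3PTLB for a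
UNION of clusters (the point versions are `ThreePointLB.cl_splice_touch` etc. of
`…ThreePointLBSwitchingClusters`, whose general-`W` lemmas are reused), and self-determination of the exploration
`K ↦ touch (clS K A)` [Gladkov2024, Example 2.5 / Lemma 3.1 for one cluster: `Gladkov.selfDetermined_touch_cl`].
-/

noncomputable section

namespace Summit.CriticalPhenomena.PercolationContinuityZ3.Theorems

namespace GroupThreePointLB

open Finset Literature.Probability.Percolation Literature.Probability.Percolation.DecisionTree
open Literature.Probability.Percolation.Gladkov ThreePointLB
open scoped Classical

variable {V : Type*} [Fintype V] [DecidableEq V]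

/-! ### The cluster of a vertex set and the group-connection event -/

/-- The open cluster of the vertex SET `A` in the configuration `K`: the union of the clusters of its
vertices, `clS K A = ⋃_{a ∈ A} cl K a`. [this work] -/
def clS (K : Finset (Sym2 V)) (A : Finset V) : Finset V := A.biUnion fun a => cl K a

/-- Membership in `clS`. [this work] -/
theorem mem_clS {K : Finset (Sym2 V)} {A : Finset V} {u : V} : u ∈ clS K A ↔ ∃ a ∈ A, u ∈ cl K a := by
  rw [clS, Finset.mem_biUnion]

/-- The group-connection event `A ~ B`: some vertex of `A` is joined to some vertex of `B` by an open path.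
Its complement is the group separation `D[A|B]`. [this work] -/
def gconn (A B : Finset V) : Set (Finset (Sym2 V)) := {K | ∃ a ∈ A, ∃ b ∈ B, b ∈ cl K a}

omit [DecidableEq V] in
/-- Membership in `gconn`. [this work] -/
theorem mem_gconn {A B : Finset V} {K : Finset (Sym2 V)} : K ∈ gconn A B ↔ ∃ a ∈ A, ∃ b ∈ B, b ∈ cl K a :=
  Iff.rfl

/-- `A ~ B` iff `B` meets the cluster of `A`. [this work] -/
theorem mem_gconn_iff_clS {A B : Finset V} {K : Finset (Sym2 V)} : K ∈ gconn A B ↔ ∃ b ∈ B, b ∈ clS K A := by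
  rw [mem_gconn]
  constructor
  · rintro ⟨a, ha, b, hb, hab⟩
    exact ⟨b, hb, mem_clS.2 ⟨a, ha, hab⟩⟩
  · rintro ⟨b, hb, hbA⟩
    obtain ⟨a, ha, hab⟩ := mem_clS.1 hbA
    exact ⟨a, ha, b, hb, hab⟩

omit [DecidableEq V] in
/-- Symmetry of group connection. [this work] -/
theorem mem_gconn_comm {A B : Finset V} {K : Finset (Sym2 V)} : K ∈ gconn A B ↔ K ∈ gconn B A := by
  simp only [mem_gconn]
  constructor
  · rintro ⟨a, ha, b, hb, h⟩
    exact ⟨b, hb, a, ha, mem_cl_comm.1 h⟩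
  · rintro ⟨b, hb, a, ha, h⟩
    exact ⟨a, ha, b, hb, mem_cl_comm.1 h⟩

omit [DecidableEq V] in
/-- Group connection to a single vertex. [this work] -/
theorem mem_gconn_singleton {A : Finset V} {c : V} {K : Finset (Sym2 V)} :
    K ∈ gconn A {c} ↔ ∃ a ∈ A, c ∈ cl K a := by
  simp only [mem_gconn, Finset.mem_singleton, exists_eq_left]

/-- Every vertex of `A` lies in `clS K A`. [this work] -/
theorem mem_clS_of_mem {K : Finset (Sym2 V)} {A : Finset V} {a : V} (ha : a ∈ A) : a ∈ clS K A :=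
  mem_clS.2 ⟨a, ha, mem_cl_self K a⟩

/-- **Saturation**: the cluster of any vertex of `clS K A` is contained in `clS K A`. [this work] -/
theorem cl_subset_clS {K : Finset (Sym2 V)} {A : Finset V} {u : V} (hu : u ∈ clS K A) : cl K u ⊆ clS K A := by
  obtain ⟨a, ha, hua⟩ := mem_clS.1 hu
  intro v hv
  exact mem_clS.2 ⟨a, ha, mem_cl_trans hua hv⟩

/-- A vertex joined to a vertex outside `clS K A` is outside `clS K A`. [this work] -/
theorem not_mem_clS_of_mem_cl {K : Finset (Sym2 V)} {A : Finset V} {u v : V} (hu : u ∉ clS K A)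
    (hv : v ∈ cl K u) : v ∉ clS K A := fun h => hu (cl_subset_clS h (mem_cl_comm.1 hv))

/-- `A ~ B` in `K` iff the clusters `clS K A` and `clS K B` meet; contrapositive form: if `A ≁ B` then a vertex of
`clS K B` is not in `clS K A`. [this work] -/
theorem not_mem_clS_of_mem_clS {K : Finset (Sym2 V)} {A B : Finset V} (h : K ∉ gconn A B) {u : V}
    (hu : u ∈ clS K B) : u ∉ clS K A := by
  intro huA
  obtain ⟨b, hb, hub⟩ := mem_clS.1 hu
  obtain ⟨a, ha, hua⟩ := mem_clS.1 huA
  exact h ⟨a, ha, b, hb, mem_cl_trans hua (mem_cl_comm.1 hub)⟩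

/-! ### Self-determination of the exploration of a vertex set -/

/-- **The cluster of a set is determined by the pairs touching it**: if `K'` agrees with `K` on `touch (clS K A)`
then `clS K' A = clS K A`. [this work] -/
theorem clS_eq_of_agree {K K' : Finset (Sym2 V)} {A : Finset V}
    (h : ∀ e ∈ touch (clS K A), (e ∈ K ↔ e ∈ K')) : clS K' A = clS K A := by
  ext u
  simp only [mem_clS]
  constructor
  · rintro ⟨a, ha, hu⟩
    refine ⟨a, ha, ?_⟩
    rwa [cl_eq_of_agree_of_subset (touch_mono (cl_subset_clS (mem_clS_of_mem ha))) h] at hu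
  · rintro ⟨a, ha, hu⟩
    refine ⟨a, ha, ?_⟩
    rwa [cl_eq_of_agree_of_subset (touch_mono (cl_subset_clS (mem_clS_of_mem ha))) h]

/-- The exploration `K ↦ touch (clS K A)` of the cluster of a vertex set is self-determined.
[cite: Gladkov2024, Example 2.5 and Lemma 3.1 (one cluster); this work (union)] -/
theorem selfDetermined_touch_clS (A : Finset V) : SelfDetermined fun K : Finset (Sym2 V) => touch (clS K A) :=
  fun K K' h => by simp only at h ⊢; rw [clS_eq_of_agree h]

/-- The second region of the two-region switchings is determined on the union of the two regions
(`W₂ = clS · B` after `W₁ = clS · A`). [this work] -/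
theorem touch_clS_sdiff_congr (A B : Finset V) (K K' : Finset (Sym2 V))
    (h : ∀ i ∈ touch (clS K A) ∪ (touch (clS K B) \ touch (clS K A)), (i ∈ K ↔ i ∈ K')) :
    touch (clS K' B) \ touch (clS K' A) = touch (clS K B) \ touch (clS K A) := by
  have hA : clS K' A = clS K A := clS_eq_of_agree fun e he => h e (Finset.mem_union_left _ he)
  have hB : clS K' B = clS K B := by
    refine clS_eq_of_agree fun e he => h e ?_
    by_cases he' : e ∈ touch (clS K A)
    · exact Finset.mem_union_left _ he'
    · exact Finset.mem_union_right _ (Finset.mem_sdiff.2 ⟨he, he'⟩)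
  rw [hA, hB]

/-- `clS K {c} = cl K c`. [this work] -/
theorem clS_singleton (K : Finset (Sym2 V)) (c : V) : clS K {c} = cl K c := by
  rw [clS, Finset.singleton_biUnion]

/-! ### F1–F3 for a union of clusters -/

/-- **(F1)** For `u ∈ W = clS X A`: in `X on touch W, ω elsewhere` the cluster of `u` is its `X`-cluster (the pairs
inside `W` carry `X`; every pair leaving `W` meets it, carries `X` and is `X`-closed). [this work] -/
theorem cl_splice_touch_clS {X : Finset (Sym2 V)} {A : Finset V} (ω : Finset (Sym2 V)) {u : V}
    (hu : u ∈ clS X A) : cl (splice (touch (clS X A)) X ω) u = cl X u :=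
  cl_eq_of_agree_of_subset (touch_mono (cl_subset_clS hu)) fun _ he => (mem_splice_of_mem he).symm

/-- A pair open in `X on touch W, ω elsewhere` (`W = clS X A`) with one endpoint off `W` has both endpoints
off `W`. [this work] -/
theorem not_mem_clS_of_adj_splice_touch {X ω : Finset (Sym2 V)} {A : Finset V} {y y' : V} (hy : y ∉ clS X A)
    (h : (openGraph (↑(splice (touch (clS X A)) X ω) : Set (Sym2 V))).Adj y y') : y' ∉ clS X A := by
  intro hy'
  rw [adj_iff] at h
  have heX : s(y, y') ∈ X := (mem_splice_of_mem (mk_mem_touch.2 (Or.inr hy'))).1 h.1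
  exact hy (cl_subset_clS hy' (mem_cl_of_adj (mem_cl_self X y')
    (adj_iff.2 ⟨by rw [Sym2.eq_swap]; exact heX, h.2.symm⟩)))

/-- **(F2)** For `u ∉ W = clS X A`: in `X on touch W, ω elsewhere`, `u` is joined to `u'` iff it is joined to
`u'` by `ω`-open pairs not meeting `W`. [this work] -/
theorem mem_cl_splice_touch_clS_iff_of_not_mem {X ω : Finset (Sym2 V)} {A : Finset V} {u : V}
    (hu : u ∉ clS X A) (u' : V) :
    u' ∈ cl (splice (touch (clS X A)) X ω) u ↔ u' ∈ cl (ω \ touch (clS X A)) u := by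
  constructor
  · intro h
    obtain ⟨w⟩ := mem_cl.1 h
    refine mem_cl.2 (reachable_of_walk (C := Finset.univ.filter fun y => y ∉ clS X A) ?_ ?_ w
      (Finset.mem_filter.2 ⟨Finset.mem_univ _, hu⟩))
    · intro y y' hy hyy'
      exact Finset.mem_filter.2 ⟨Finset.mem_univ _,
        not_mem_clS_of_adj_splice_touch (Finset.mem_filter.1 hy).2 hyy'⟩
    · intro y y' hy hyy'
      have hyW := (Finset.mem_filter.1 hy).2
      have hy'W := not_mem_clS_of_adj_splice_touch hyW hyy'
      rw [adj_iff] at hyy' ⊢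
      have he : s(y, y') ∉ touch (clS X A) := by rw [mk_mem_touch, not_or]; exact ⟨hyW, hy'W⟩
      exact ⟨Finset.mem_sdiff.2 ⟨(mem_splice_of_not_mem he).1 hyy'.1, he⟩, hyy'.2⟩
  · intro h
    exact cl_mono (sdiff_subset_splice subset_rfl) u h

/-- **(F3)** For `u ∉ W = clS X A`: the `X`-cluster of `u` survives in `ω on touch W, X elsewhere`. [this work] -/
theorem cl_subset_cl_splice_touch_clS_of_not_mem {X ω : Finset (Sym2 V)} {A : Finset V} {u : V}
    (hu : u ∉ clS X A) : cl X u ⊆ cl (splice (touch (clS X A)) ω X) u := by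
  intro u' hu'
  obtain ⟨w⟩ := mem_cl.1 hu'
  refine mem_cl.2 (reachable_of_walk (C := cl X u) (fun y y' hy hyy' => mem_cl_of_adj hy hyy') ?_ w
    (mem_cl_self X u))
  intro y y' hy hyy'
  have hy' : y' ∈ cl X u := mem_cl_of_adj hy hyy'
  have hyW : y ∉ clS X A := not_mem_clS_of_mem_cl hu hy
  have hy'W : y' ∉ clS X A := not_mem_clS_of_mem_cl hu hy'
  rw [adj_iff] at hyy' ⊢
  have he : s(y, y') ∉ touch (clS X A) := by rw [mk_mem_touch, not_or]; exact ⟨hyW, hy'W⟩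
  exact ⟨(mem_splice_of_not_mem he).2 hyy'.1, hyy'.2⟩

/-! ### F4 for unions of clusters -/

/-- **(F4, i)** If `u ∈ W = clS X B` and `W` does not meet `W' = clS X A`, the `X`-cluster of `u` is still
connected in `X on touch W \ touch W', ω elsewhere` (its internal `X`-open pairs meet `W` and not `W'`). [this work] -/
theorem cl_subset_cl_splice_sdiff_clS {X : Finset (Sym2 V)} {A B : Finset V} (hAB : X ∉ gconn A B) {u : V}
    (hu : u ∈ clS X B) (ω : Finset (Sym2 V)) :
    cl X u ⊆ cl (splice (touch (clS X B) \ touch (clS X A)) X ω) u := by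
  intro v hv
  obtain ⟨w⟩ := mem_cl.1 hv
  refine mem_cl.2 (reachable_of_walk (C := cl X u) (fun y y' hy hyy' => mem_cl_of_adj hy hyy') ?_ w
    (mem_cl_self X u))
  intro y y' hy hyy'
  have hy' : y' ∈ cl X u := mem_cl_of_adj hy hyy'
  have hyB : y ∈ clS X B := cl_subset_clS hu hy
  have hyA : y ∉ clS X A := not_mem_clS_of_mem_clS hAB hyB
  have hy'A : y' ∉ clS X A := not_mem_clS_of_mem_clS hAB (cl_subset_clS hu hy')
  rw [adj_iff] at hyy' ⊢
  have he : s(y, y') ∈ touch (clS X B) \ touch (clS X A) :=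
    Finset.mem_sdiff.2 ⟨mk_mem_touch.2 (Or.inl hyB), by rw [mk_mem_touch, not_or]; exact ⟨hyA, hy'A⟩⟩
  exact ⟨(mem_splice_of_mem he).2 hyy'.1, hyy'.2⟩

/-- (F4, ii) is `ThreePointLB.cl_sdiff_touch_subset_cl_splice` (general `W`); recorded here in the form used:
an `ω`-path avoiding `clS X A` stays open in `X on F, ω elsewhere` for `F ⊆ touch (clS X A)`. [this work] -/
theorem cl_sdiff_touch_clS_subset_cl_splice {F X ω : Finset (Sym2 V)} {A : Finset V}
    (hF : F ⊆ touch (clS X A)) (u : V) : cl (ω \ touch (clS X A)) u ⊆ cl (splice F X ω) u :=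
  cl_sdiff_touch_subset_cl_splice hF u

/-! ### Group connections read off inside the sealed outputs -/

/-- (F1 for groups) In `X on touch (clS X A), ω elsewhere`: `A ~ B` iff `A ~ B` in `X`. [this work] -/
theorem splice_touch_clS_mem_gconn_iff {X : Finset (Sym2 V)} {A : Finset V} (ω : Finset (Sym2 V)) (B : Finset V) :
    splice (touch (clS X A)) X ω ∈ gconn A B ↔ X ∈ gconn A B := by
  simp only [mem_gconn]
  constructor
  · rintro ⟨a, ha, b, hb, h⟩
    rw [cl_splice_touch_clS ω (mem_clS_of_mem ha)] at h
    exact ⟨a, ha, b, hb, h⟩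
  · rintro ⟨a, ha, b, hb, h⟩
    refine ⟨a, ha, b, hb, ?_⟩
    rw [cl_splice_touch_clS ω (mem_clS_of_mem ha)]
    exact h

/-- (F2 for groups) In `X on touch (clS X A), ω elsewhere`, for sets `B, C` not meeting `clS X A`: `B ~ C` iff
`B ~ C` by `ω`-pairs avoiding `clS X A`. [this work] -/
theorem splice_touch_clS_mem_gconn_iff_of_disjoint {X : Finset (Sym2 V)} {A B C : Finset V} (ω : Finset (Sym2 V))
    (hB : ∀ b ∈ B, b ∉ clS X A) :
    splice (touch (clS X A)) X ω ∈ gconn B C ↔ ω \ touch (clS X A) ∈ gconn B C := by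
  simp only [mem_gconn]
  constructor
  · rintro ⟨b, hb, c, hc, h⟩
    exact ⟨b, hb, c, hc, (mem_cl_splice_touch_clS_iff_of_not_mem (hB b hb) c).1 h⟩
  · rintro ⟨b, hb, c, hc, h⟩
    exact ⟨b, hb, c, hc, (mem_cl_splice_touch_clS_iff_of_not_mem (hB b hb) c).2 h⟩

/-- A group connection by pairs of `ω` avoiding a set is a group connection in `ω`. [this work] -/
theorem mem_gconn_of_sdiff_mem_gconn {ω F : Finset (Sym2 V)} {B C : Finset V} (h : ω \ F ∈ gconn B C) :
    ω ∈ gconn B C := by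
  obtain ⟨b, hb, c, hc, hbc⟩ := h
  exact ⟨b, hb, c, hc, cl_mono Finset.sdiff_subset b hbc⟩

end GroupThreePointLB

end Summit.CriticalPhenomena.PercolationContinuityZ3.Theorems

end
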